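import Summits.ValiantsHypothesis.ValiantsHypothesis.Theorems.LacunarySymmetroidMatrixDescartesCensusV19SSoundCaseA

/-!
# `MatrixDescartes` census — soundness of the 2-SIDON `V = 19` checker: `V19S.posRootLawOn_of_certs`, `V19S.posRootLawOn_of_slices8`

HONEST FRAMING.  Object-search cell `pub-symmetroid`; door-A item `DoorA26 = PosRootLawAt 2 6 19`
(stmt-ValiantsHypothesis-19979; OPEN, typed, never asserted).  Conclusion of the proof that certificates accepted by `V19S.certOK`
(`…CensusV19SCheck`) exclude a nineteen — `19` distinct positive det-roots of a six-term real symmetric `2 × 2` pencil — on a 2-Sidon support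
WHOSE `V = 20` ROW `PosRootLawOn 2 6 19 d` IS KNOWN (hypothesis; in the kernel for every sorted 2-Sidon support with `d₅ − d₀ ≤ 24`,
`…CensusV20Box24`): such a pencil has either a vanishing coefficient (Case B, `…CensusV19SSoundCaseB`) or — its sign variations being `≤ 19`
by the `V = 20` row (`Census.signVariations_le_nineteen_of_posRootLawOn`) — exactly one repetition (Case A, `…CensusV19SSoundCaseA`); either way it
realises a well-formed cell `(s, mode)` and supplies a `V19S.Model` there, which the cell's accepted certificate refutes (`V19S.certOK_sound`).
`V19S.posRootLawOn_of_slices8` packages the `82` cells of a support into the eight slices the data files check by `decide +kernel`.  Nothing here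
bears on the one-collision supports, on `ζ_sym(2,6)` over all supports, on `DoorA26` itself, on `MatrixDescartes` (stmt-ValiantsHypothesis-18050)
or on `VP ≠ VNP`.

[folklore] Certificate-checker soundness; elementary.
-/

-- the D-0017 layout repeats a namespace component (single-conjunct summit); the `dupNamespace` linter flags it; name mandated.
set_option linter.dupNamespace false

namespace Summit.ValiantsHypothesis.ValiantsHypothesis.Theorems.LacunarySymmetroidMatrixDescartes.Census.V19S

open V20 (Atom allAtoms psum posOf ordOK sums sortAtoms qA cA Epos aval pdet dfun)

section Nineteen

open Polynomial Finset
open scoped BigOperators Polynomial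

variable {dl : List ℕ} {ord : List Atom} {S : Fin 6 → Matrix (Fin 2) (Fin 2) ℝ}

/-- **A nineteen yields a model** (given the `V = 20` row of its support): a pencil with `19` distinct positive det-roots on a support passing
`V20.ordOK` realises a well-formed cell — Case B at a vanishing coefficient, else Case A at its unique repetition — and supplies a `V19S.Model`
there, in branch `none`. [folklore] -/
theorem model_of_nineteen (h : ordOK dl ord = true) (hS : ∀ l, (S l).IsSymm)
    (h19 : 19 ≤ ((pdet dl S).roots.toFinset.filter (fun t => 0 < t)).card) (h20 : PosRootLawOn 2 6 19 (dfun dl)) :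
    ∃ (s : Bool) (m : Mode) (x : ℕ → ℝ), m.ok = true ∧ Model (mkCtx dl ord s m none) x (aval S) := by
  by_cases hB : ∃ z, z < 21 ∧ (pdet dl S).coeff (Epos dl ord z) = 0
  · obtain ⟨z, hz, hcz⟩ := hB
    exact ⟨_, .B z, _, by simp only [Mode.ok, decide_eq_true_eq]; omega, modelB_of_nineteen h hS h19 hz hcz⟩
  · push Not at hB
    obtain ⟨k, hk, hrep, halt⟩ := exists_repetition h hS h19 h20 hB
    exact ⟨_, .A k, _, by simp only [Mode.ok, decide_eq_true_eq]; omega, modelA_of_nineteen h hS h19 hB hk hrep halt⟩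

/-! ### The main theorems -/

/-- What `cellsOK` establishes: every listed cell carries an accepted certificate. [folklore] -/
theorem cellsOK_spec (d : List ℕ) (ord : List Atom) :
    ∀ (L : List (Bool × Mode)) (cs : List Cert), cellsOK d ord L cs = true →
      ∀ (s : Bool) (m : Mode), (s, m) ∈ L → ∃ ct, certOK (mkCtx d ord s m none) ct = true
  | [], _, _, s, m, hsm => by simp at hsm
  | (s', m') :: L, [], h, _, _, _ => by simp [cellsOK] at h
  | (s', m') :: L, ct :: cs, h, s, m, hsm => by
    simp only [cellsOK, Bool.and_eq_true] at h
    rcases List.mem_cons.1 hsm with he | hsm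
    · simp only [Prod.mk.injEq] at he
      obtain ⟨rfl, rfl⟩ := he
      exact ⟨ct, h.1.2⟩
    · exact cellsOK_spec d ord L cs h.2 s m hsm

/-- What `checkCells` establishes: the order passed, and every listed cell carries an accepted certificate. [folklore] -/
theorem checkCells_spec {dl : List ℕ} {L : List (Bool × Mode)} {cs : List Cert} (h : checkCells dl L cs = true) :
    ordOK dl (sortAtoms dl) = true ∧ ∀ (s : Bool) (m : Mode), (s, m) ∈ L → ∃ ct, certOK (mkCtx dl (sortAtoms dl) s m none) ct = true := by
  unfold checkCells at h
  simp only [Bool.and_eq_true] at h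
  exact ⟨h.1, cellsOK_spec dl (sortAtoms dl) L cs h.2⟩

/-- Membership in a Case-A slice. [folklore] -/
theorem mem_sliceA (s : Bool) {k lo hi : ℕ} (h1 : lo ≤ k) (h2 : k < hi) : (s, Mode.A k) ∈ sliceA s lo hi := by
  unfold sliceA
  rw [List.mem_map]
  exact ⟨k, List.mem_range'_1.2 ⟨h1, by omega⟩, rfl⟩

/-- Membership in a Case-B slice. [folklore] -/
theorem mem_sliceB (s : Bool) {z lo hi : ℕ} (h1 : lo ≤ z) (h2 : z < hi) : (s, Mode.B z) ∈ sliceB s lo hi := by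
  unfold sliceB
  rw [List.mem_map]
  exact ⟨z, List.mem_range'_1.2 ⟨h1, by omega⟩, rfl⟩

/-- **Soundness of the 2-Sidon `V = 19` checker**: if every well-formed cell of a support passing `V20.ordOK` carries an accepted certificate,
and the support has no twenty, then it has no nineteen — `ζ(2,6; d) ≤ 18`. [folklore] -/
theorem posRootLawOn_of_certs (dl : List ℕ) (hord : ordOK dl (sortAtoms dl) = true)
    (hall : ∀ (s : Bool) (m : Mode), m.ok = true → ∃ ct, certOK (mkCtx dl (sortAtoms dl) s m none) ct = true)
    (h20 : PosRootLawOn 2 6 19 (fun i => dl.getD i 0)) : PosRootLawOn 2 6 18 (fun i => dl.getD i 0) := by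
  intro S hS
  by_contra hlt
  have h19 : 19 ≤ ((pdet dl S).roots.toFinset.filter (fun t => 0 < t)).card := by
    unfold pdet dfun; push Not at hlt; exact hlt
  obtain ⟨s, m, x, hm, M⟩ := model_of_nineteen hord hS h19 h20
  obtain ⟨ct, hct⟩ := hall s m hm
  exact certOK_sound M hct

/-- **Soundness, eight-slice form** (the shape of the data files): the `82` cells of a support split as Case A `k < 10` / `10 ≤ k < 20` and
Case B `z < 11` / `11 ≤ z ≤ 20` in both orientations; if each slice passes `V19S.checkCells` and the support has no twenty, it has no
nineteen. [folklore] -/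
theorem posRootLawOn_of_slices8 {dl : List ℕ} {c1 c2 c3 c4 c5 c6 c7 c8 : List Cert}
    (h1 : checkCells dl (sliceA true 0 10) c1 = true) (h2 : checkCells dl (sliceA true 10 20) c2 = true)
    (h3 : checkCells dl (sliceA false 0 10) c3 = true) (h4 : checkCells dl (sliceA false 10 20) c4 = true)
    (h5 : checkCells dl (sliceB true 0 11) c5 = true) (h6 : checkCells dl (sliceB true 11 21) c6 = true)
    (h7 : checkCells dl (sliceB false 0 11) c7 = true) (h8 : checkCells dl (sliceB false 11 21) c8 = true)
    (h20 : PosRootLawOn 2 6 19 (fun i => dl.getD i 0)) : PosRootLawOn 2 6 18 (fun i => dl.getD i 0) := by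
  obtain ⟨hord, H1⟩ := checkCells_spec h1
  obtain ⟨-, H2⟩ := checkCells_spec h2
  obtain ⟨-, H3⟩ := checkCells_spec h3
  obtain ⟨-, H4⟩ := checkCells_spec h4
  obtain ⟨-, H5⟩ := checkCells_spec h5
  obtain ⟨-, H6⟩ := checkCells_spec h6
  obtain ⟨-, H7⟩ := checkCells_spec h7
  obtain ⟨-, H8⟩ := checkCells_spec h8
  refine posRootLawOn_of_certs dl hord (fun s m hm => ?_) h20
  cases m with
  | A k =>
    have hk : k < 20 := by simpa [Mode.ok] using hm
    cases s with
    | false =>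
      by_cases hk10 : k < 10
      · exact H3 false (.A k) (mem_sliceA false (Nat.zero_le k) hk10)
      · exact H4 false (.A k) (mem_sliceA false (not_lt.1 hk10) hk)
    | true =>
      by_cases hk10 : k < 10
      · exact H1 true (.A k) (mem_sliceA true (Nat.zero_le k) hk10)
      · exact H2 true (.A k) (mem_sliceA true (not_lt.1 hk10) hk)
  | B z =>
    have hz : z ≤ 20 := by simpa [Mode.ok] using hm
    cases s with
    | false =>
      by_cases hz11 : z < 11
      · exact H7 false (.B z) (mem_sliceB false (Nat.zero_le z) hz11)
      · exact H8 false (.B z) (mem_sliceB false (not_lt.1 hz11) (by omega))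
    | true =>
      by_cases hz11 : z < 11
      · exact H5 true (.B z) (mem_sliceB true (Nat.zero_le z) hz11)
      · exact H6 true (.B z) (mem_sliceB true (not_lt.1 hz11) (by omega))

end Nineteen

end Summit.ValiantsHypothesis.ValiantsHypothesis.Theorems.LacunarySymmetroidMatrixDescartes.Census.V19S
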